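import Summits.QuantumFields.BalabanUV.Beta.FP.KKTSecondVariation
import Summits.QuantumFields.BalabanUV.Beta.LogZFirstJet
import Summits.QuantumFields.BalabanUV.Beta.PolarizationComposite
import Summits.QuantumFields.BalabanUV.Beta.FP.ConstraintNormalisation

/-!
# `BalabanUV.Beta.FP.OneShotKKTPolarization` — road «FP» for binder row D1, organisation γ, row **GAMMA-0, half (b)** (owner memo `GAMMA-DESIGN.md`
# v1.2 8a6d65e77efc8fe3, LEAVES-FP l.368, journal l.24227): THE KKT EXPANSION IN THE `polarization` ∕ `hessianAt` ∕ `torusKernel` CURRENCY of pv25's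
# `OneLoop` and an2's K-U2 series (half (a), the CURVE form `t ↦ W_n(t·v)` through `ConstrainedCriticalMap`, is beta-d1-formalise-leaf-05-g11's
# `FP/OneShotKKTTorus.lean`, first refusal exercised l.24323 ∕ SHAPE l.24436 — disjoint objects, nothing of it restated) — the one-loop polarization of a
# finite-volume background family IS the six loops of `KKTSecondVariation.sixLoops_kkt` with legs `Γ = flucCov`, `𝓘 = minOp`, `𝔊 = effForm` of the
# base-point bordered inverse; read on the torus kernels; and THROUGH THE MINIMISER `V ↦ U V`: transported on both legs by `J = DU(0)` plus the
# TADPOLE·`U″` term, which the block form of the first jet makes explicit and tadpole-freeness (S4) kills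

HONEST DEPENDENCY (page 1, mandatory): continuum YM on T⁴ ⇐ BetaPertH ∧ nine spine estimates (0/9 proved); BetaPertH ⇐ (D1) ∧ (D4) ∧ CAP+tail;
G-an2-4 gates asym, D1 and NE2/3/4.  HONEST FRAMING (cell contract, verbatim): «discharging `BetaPertH` makes Bałaban's UV stability UNCONDITIONAL —
a real constructive-QFT result; it is NOT the continuum limit and NOT the Clay problem.»  THIS MODULE DISCHARGES NOTHING of the wall: it is [folklore]
finite-dimensional calculus ∕ block algebra assembling, BY NAME, pv09∕an2's `LogDetHessian.Family.polarization_master` (Jacobi's second-order formula in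
blocks), an2's `CompositionSingular.kktInv_eq_fromBlocks` ∕ `minOpL_eq_transpose` (the blocks ARE `flucCov ∕ minOp ∕ effForm`), an2's K-U4
`LogZFirstJet.fderiv_logZ_single_blocks_of_symm` (the tadpole vector in blocks), an2's K-U2 `PolarizationComposite.hessianAt_comp_eq` (second-order chain
rule through the minimiser), leaf-04's GAMMA-7 `ConstraintNormalisation.polarization_eq_hessianAt_negHalfLogAbsDetKKT` (the normalisation drops out) and
RHOA-10 `KKTSecondVariation.sixLoops_kkt` (the curve form).  The background families `F`, the minimiser map `U`, the ghost functional `Gh` are PARAMETERS;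
every regularity ∕ nonsingularity ∕ symmetry ∕ Fubini hypothesis is DISPLAYED.  No `def`, no `def … : Prop`, nothing cited, 0 sorry; 0 estimates; 0∕4
row-D1 binders; NOT D1, NOT BetaPertH, NOT continuum, NOT Clay.

ABSOLUTE RULE (cell charter, verbatim): «No internally-minted statement may enter as a cited fact. Every hypothesis is either kernel-proved in this
package or a verbatim quotation of a PUBLISHED theorem with page reference. The manuscript(s) under audit are NOT citable for their own disputed steps —
they are the thing under adjudication; programme-internal (2001/route/tribunal) claims are never citable.»

THE ROW (LEAVES-FP l.368, owner d1-p3-g6, verbatim up to notation): «on a finite torus at level 0 (every object a finite matrix), the covariant-slice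
one-shot functional `W_n(V) := −½log|det kkt(H_cov(U_n V), Q_{U_nV})|` along `V = t·v` has second derivative at 0 given by `KKTSecondVariation.sixLoops_kkt`
with `H₁ = d/dt H_cov(U_n(tv))|₀` (= `Ḣ_cov[𝓘v]` by the chain rule through the minimiser; S4 kills the `U_n″` term), `Q₁ = Q̇[𝓘v]`, `H₂, Q₂` the second
jets; output = the six loops as a bilinear form in `v` with legs (`flucCov`, `minOp`, `effForm`) …, + `ConstraintNormalisation` ✓ (GAMMA-7) + the
K_n-ghost term».  READING ∕ SCOPE: the tree holds no lattice-gauge-theory construction of `H_cov(B)`, `Q_B`, `U_n` on a torus; as in an2's K-U2 series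
(`PolarizationFubini`, `LogZFubiniCompSlice`, `KKTInverseRegularity`) they enter as a background FAMILY `F B = (Q_B, Δ_B := H_cov(B))` (pv25's
`OneLoop.Family`, finite volume = every object a finite matrix), a `C²` map `U` with `U 0 = 0` and a `C²` scalar `Gh`; the conclusions are identities
for pv25's `polarization` ∕ `hessianAt` ∕ `torusKernel`.  The identification `J := DU_n(0) = 𝓘_n` (RHOA-DESIGN §0 «`δB = 𝓘_nδV`») and the blocking to
level `j` of the `(j,m)` family are properties of the road's concrete family — NOT asserted here (the statements hold for every `J`).

CONTENT (all [folklore]; `F : Family κ n m`, `Γ := flucCov (F 0).Δ (F 0).Q`, `𝓘 := minOp …`, `𝔊 := effForm …`; jets `F.dΔ ∕ dQ ∕ d2Δ ∕ d2Q` of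
`LogDetHessian`):
§1 LEVEL 0, ANY FINITE BACKGROUND INDEX.  **`polarization_eq_sixLoops`** — `C²` entries at `0`, `det K₀ ≠ 0`, `Δ_B` symmetric near `0` ⟹
   `polarization F i j = −½tr(Γ∂ᵢ∂ⱼΔ) + ½tr(Γ∂ᵢΔΓ∂ⱼΔ) − tr(𝓘∂ᵢ∂ⱼQ) + tr(𝓘∂ᵢQ𝓘∂ⱼQ) − tr(Γ∂ᵢQᵀ𝔊∂ⱼQ) + tr(Γ∂ᵢΔ𝓘∂ⱼQ) + tr(Γ∂ⱼΔ𝓘∂ᵢQ)` (the POLARIZED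
   six loops: `polarization_master` at the block decomposition `K₀⁻¹ = [[Γ, 𝓘],[𝓘ᵀ, −𝔊]]`); **`polarization_diag_eq_sixLoops_kkt`** — on the diagonal this IS
   RHOA-10's display: `polarization F i i = −½·secondVar (kkt Δ₀ Q₀) (kkt ∂ᵢΔ ∂ᵢQ) (kkt ∂ᵢ∂ᵢΔ ∂ᵢ∂ᵢQ)` (= `sixLoops_kkt`'s right member) — the curve form
   and the Fréchet form of the one shot agree.
§2 TORUS.  **`torusKernel_eq_sixLoops`** — pv25's torus kernel `Π⁰_{μν}(x)` of a torus family is the polarized six loops at `i = ((x,μ),a₀)`,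
   `j = ((0,ν),a₀)`; **`torusKernel_eq_hessianAt_W`** — and it is the Hessian of `W := B ↦ −½log|det kkt(F B)|` ALONE (GAMMA-7 ✓: the Lie-algebra
   normalisation is a constant).
§3 THROUGH THE MINIMISER (the one shot `Φ(V) = log Z(U V) + Gh(V) + c` near `V = 0`; `U 0 = 0`, `U`, `Gh` `C²` at `0`; `J_{ia} := ∂ᵢU_a(0)`,
   `U″_{a,ij} := ∂ᵢ∂ⱼU_a(0)`).  **`hessianAt_oneShot_eq`** —
   `hessianAt Φ i j = Σ_a Σ_b J_{ia}J_{jb}·[six loops]_{ab} + hessianAt Gh i j + Σ_a U″_{a,ij}·(−½tr(Γ∂_aΔ) − tr(𝓘∂_aQ))`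
   (transport on both legs + ghost + TADPOLE·second response, the tadpole in BLOCK form); **`hessianAt_oneShot_eq_of_tadpoleFree`** — if every
   single-insertion contraction vanishes, `−½tr(Γ∂_aΔ) − tr(𝓘∂_aQ) = 0` for all `a` (S4 in functional form; cf. `LogZFirstJet.fderiv_logZ_eq_zero_of_parity`),
   the `U″` term is ABSENT: `hessianAt Φ i j = Σ_a Σ_b J_{ia}J_{jb}·[six loops]_{ab} + hessianAt Gh i j`.
§4 TRANSPORTED JETS IN CLOSED FORM.  **`sixLoops_transport`** (pure bilinear algebra: contracting the `(a,b)`-six loops with `x_a y_b` = the six loops of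
   `Ḣ[x] = Σ x_a∂_aΔ`, `Ḧ[x,y] = Σ x_a y_b∂_a∂_bΔ`, …); **`hessianAt_oneShot_eq_transported`** (§3 with `Ḣᵢ = Ḣ[Jᵢ]`, `Ḧᵢⱼ = Ḧ[Jᵢ,Jⱼ]`, … displayed);
   **`hessianAt_oneShot_diag_eq_sixLoops_kkt_of_tadpoleFree`** — the row's sentence: tadpole-free, `hessianAt Φ i i = −½·secondVar (kkt Δ₀ Q₀) (kkt Ḣᵢ Q̇ᵢ)
   (kkt Ḧᵢᵢ Q̈ᵢᵢ) + hessianAt Gh i i`, i.e. `W_n″(0)` along `V = t·eᵢ` is RHOA-10's `sixLoops_kkt` with `H₁ = Ḣ[Jeᵢ]`, `Q₁ = Q̇[Jeᵢ]` and the transported second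
   jets, plus the ghost.
§5 (companion file `FP/OneShotKKTPolarizationLine.lean`, ≤ 400-line rule): the JUNCTION WITH HALF (a) in the curve currency — `hessianAt f i i` IS the derivative at `0`
   of the first-derivative field of `t ↦ f(t·eᵢ)`, hence the row's sentence in half (a)'s `HasDerivAt` shape.
SPLIT OF THE ROW (journal): half (a) = leaf-05-g11's `FP/OneShotKKTTorus` — `HasDerivAt` statements along the composite CURVE `u ↦ (H_cov(γ u), Q_{γ u})`,
`γ = U_n(c₀ + s·v)`, `γ̇(0) = 𝓘v` from an2's `ConstrainedCriticalMap`, the `γ̈`-tadpole displayed; half (b) = THIS FILE — the same expansion as identities for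
pv25's `polarization` ∕ `hessianAt` ∕ `torusKernel` (the currency of `PolarizationFubini` ∕ `PolarizationComposite` ∕ `LogZFirstJet` ∕ GAMMA-7), with the
ghost addend and the tadpole·`U″` term in blocks, and the CHECK that the two currencies agree on the diagonal (`polarization_diag_eq_sixLoops_kkt`).
Provenance: cross-cell idle seat b2b-balaban-t4-ne7b-formalise-leaf-09 (gen 20, prover-b2b-balaban-t4-ne7b-formalise-leaf-09-g20-0; author of RHOA-10
`KKTSecondVariation`) for road FP owner b2b-balaban-beta-d1-p3, 2026-08-21 (row GAMMA-0 half (b), journal INTENT «GAMMA-0 (b)»).  [folklore], 0 def, 0 cite,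
0 sorry.
-/

noncomputable section

namespace Summit.QuantumFields.BalabanUV.Beta.FP.OneShotKKTPolarization

open Filter Topology Matrix Finset
open scoped BigOperators Matrix
open Literature.MathematicalPhysics.QuantumFieldTheory.Balaban1983to89.Beta
  (hessianAt polarization Family ConstrainedGaussian torusKernel ExtIndex Site polarization_eq_hessianAt)
open Literature.MathematicalPhysics.QuantumFieldTheory.Balaban1983to89.Beta.Composition (kkt)
open Literature.MathematicalPhysics.QuantumFieldTheory.Balaban1983to89.Beta.CompositionSingular
  (effForm minOp minOpL flucCov kktInv_eq_fromBlocks minOpL_eq_transpose)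
open Summit.QuantumFields.BalabanUV.Beta.D1BFx.LogDetSecondVariation (secondVar)
open Summit.QuantumFields.BalabanUV.Beta.FP.KKTSecondVariation (sixLoops_kkt)
open Summit.QuantumFields.BalabanUV.Beta.LogZFirstJet (kkt_eq_kkt fderiv_logZ_single_blocks_of_symm)
open Summit.QuantumFields.BalabanUV.Beta.PolarizationComposite (hessianAt_comp_eq)
open Summit.QuantumFields.BalabanUV.Beta.FP.ConstraintNormalisation (polarization_eq_hessianAt_negHalfLogAbsDetKKT)

/-! ## §1 Level 0: the one-loop polarization IS the polarized six loops with legs `Γ, 𝓘, 𝔊` -/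

section LevelZero

variable {κ : Type*} [Fintype κ] [DecidableEq κ] {n m : ℕ}

/-- [folklore] The block decomposition of the base-point bordered inverse in organisation γ's legs: for symmetric `Δ₀`,
`K₀⁻¹ = [[Γ, 𝓘],[𝓘ᵀ, −𝔊]]` with `Γ = flucCov Δ₀ Q₀`, `𝓘 = minOp Δ₀ Q₀`, `𝔊 = effForm Δ₀ Q₀` (no invertibility needed: the blocks ARE those of
`(kkt Δ₀ Q₀)⁻¹`; symmetry gives `minOpL = minOpᵀ`). -/
theorem kktInv_eq_fromBlocks_gamma (Z : ConstrainedGaussian n m) (hsymm : Z.Δ.IsSymm) :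
    Z.kkt⁻¹ = Matrix.fromBlocks (flucCov Z.Δ Z.Q) (minOp Z.Δ Z.Q) (minOp Z.Δ Z.Q)ᵀ (-effForm Z.Δ Z.Q) := by
  rw [kkt_eq_kkt, kktInv_eq_fromBlocks, (minOpL_eq_transpose Z.Δ Z.Q hsymm.eq).1]

/-- [folklore] **THE ONE-LOOP POLARIZATION IS THE POLARIZED SIX LOOPS** (row GAMMA-0 at level 0, any finite background index `κ`): for a background
family `F : Family κ n m` (`F B = (Q_B, Δ_B)`, every object a finite matrix) with entries of class `C²` at `B = 0`, nonsingular bordered matrix `K₀` and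
`Δ_B` symmetric near `0`, writing `Γ = flucCov Δ₀ Q₀`, `𝓘 = minOp Δ₀ Q₀`, `𝔊 = effForm Δ₀ Q₀` and `∂ᵢΔ, ∂ᵢQ, ∂ᵢ∂ⱼΔ, ∂ᵢ∂ⱼQ` for the entrywise jets
(`LogDetHessian.Family.dΔ ∕ dQ ∕ d2Δ ∕ d2Q`):
`polarization F i j = −½tr(Γ∂ᵢ∂ⱼΔ) + ½tr(Γ∂ᵢΔΓ∂ⱼΔ) − tr(𝓘∂ᵢ∂ⱼQ) + tr(𝓘∂ᵢQ𝓘∂ⱼQ) − tr(Γ∂ᵢQᵀ𝔊∂ⱼQ) + tr(Γ∂ᵢΔ𝓘∂ⱼQ) + tr(Γ∂ⱼΔ𝓘∂ᵢQ)`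
— pv09∕an2's master formula `polarization_master` read at the block decomposition `kktInv_eq_fromBlocks_gamma`. -/
theorem polarization_eq_sixLoops (F : Family κ n m)
    (hQ : ∀ a b, ContDiffAt ℝ 2 (fun B => (F B).Q a b) 0) (hΔ : ∀ a b, ContDiffAt ℝ 2 (fun B => (F B).Δ a b) 0)
    (hdet : (F 0).kkt.det ≠ 0) (hsymm : ∀ᶠ B in 𝓝 (0 : κ → ℝ), (F B).Δ.IsSymm) (i j : κ) :
    polarization F i j =
      -(1 / 2 : ℝ) * (flucCov (F 0).Δ (F 0).Q * F.d2Δ i j).trace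
        + (1 / 2 : ℝ) * (flucCov (F 0).Δ (F 0).Q * F.dΔ i * flucCov (F 0).Δ (F 0).Q * F.dΔ j).trace
        - (minOp (F 0).Δ (F 0).Q * F.d2Q i j).trace
        + (minOp (F 0).Δ (F 0).Q * F.dQ i * minOp (F 0).Δ (F 0).Q * F.dQ j).trace
        - (flucCov (F 0).Δ (F 0).Q * (F.dQ i)ᵀ * effForm (F 0).Δ (F 0).Q * F.dQ j).trace
        + (flucCov (F 0).Δ (F 0).Q * F.dΔ i * minOp (F 0).Δ (F 0).Q * F.dQ j).trace
        + (flucCov (F 0).Δ (F 0).Q * F.dΔ j * minOp (F 0).Δ (F 0).Q * F.dQ i).trace :=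
  Family.polarization_master F hQ hΔ hdet hsymm (kktInv_eq_fromBlocks_gamma (F 0) hsymm.self_of_nhds) i j

/-- [folklore] **ON THE DIAGONAL THE FRÉCHET FORM IS RHOA-10's CURVE FORM**: under the hypotheses of `polarization_eq_sixLoops`,
`polarization F i i = −½·secondVar (kkt Δ₀ Q₀) (kkt ∂ᵢΔ ∂ᵢQ) (kkt ∂ᵢ∂ᵢΔ ∂ᵢ∂ᵢQ)`, whose right member `KKTSecondVariation.sixLoops_kkt` displays as
`½tr(ΓḢΓḢ) − ½tr(ΓḦ) + 2tr(ΓḢ𝓘Q̇) + tr(𝓘Q̇𝓘Q̇) − tr(𝔊·Q̇ΓQ̇ᵀ) − tr(𝓘Q̈)` with `Ḣ, Q̇, Ḧ, Q̈ = ∂ᵢΔ, ∂ᵢQ, ∂ᵢ∂ᵢΔ, ∂ᵢ∂ᵢQ` — the second derivative of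
`t ↦ log Z(t·eᵢ)` at `0` in both currencies. -/
theorem polarization_diag_eq_sixLoops_kkt (F : Family κ n m)
    (hQ : ∀ a b, ContDiffAt ℝ 2 (fun B => (F B).Q a b) 0) (hΔ : ∀ a b, ContDiffAt ℝ 2 (fun B => (F B).Δ a b) 0)
    (hdet : (F 0).kkt.det ≠ 0) (hsymm : ∀ᶠ B in 𝓝 (0 : κ → ℝ), (F B).Δ.IsSymm) (i : κ) :
    polarization F i i =
      -(1 / 2 : ℝ) * secondVar (kkt (F 0).Δ (F 0).Q) (kkt (F.dΔ i) (F.dQ i)) (kkt (F.d2Δ i i) (F.d2Q i i)) := by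
  rw [polarization_eq_sixLoops F hQ hΔ hdet hsymm i i,
    sixLoops_kkt _ _ _ _ _ _ hsymm.self_of_nhds.eq (F.dΔ_isSymm hsymm i).eq]
  -- the `𝔊`-term: `tr(Γ Q̇ᵀ 𝔊 Q̇) = tr(𝔊 · Q̇ (Γ Q̇ᵀ))` by cyclicity; the rest is reassociation
  have hc : (flucCov (F 0).Δ (F 0).Q * (F.dQ i)ᵀ * effForm (F 0).Δ (F 0).Q * F.dQ i).trace =
      (effForm (F 0).Δ (F 0).Q * (F.dQ i * (flucCov (F 0).Δ (F 0).Q * (F.dQ i)ᵀ))).trace := by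
    rw [Matrix.mul_assoc (flucCov (F 0).Δ (F 0).Q * (F.dQ i)ᵀ), Matrix.trace_mul_comm]
    simp only [Matrix.mul_assoc]
  rw [hc]
  simp only [Matrix.mul_assoc]
  ring

end LevelZero

/-! ## §2 The torus kernels -/

section Torus

variable {d s c n m : ℕ} [NeZero s]

/-- [folklore] **THE TORUS KERNEL IS THE POLARIZED SIX LOOPS** (row GAMMA-0, torus reading): for a torus family `F : Family (ExtIndex d s c) n m`
(external index `((x, μ), a)` = bond `⟨x, x+e_μ⟩`, colour `a`, pv25's `OneLoop` Part 3) with `C²` entries at `0`, nonsingular `K₀` and symmetric `Δ_B`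
near `0`, pv25's `torusKernel F a₀ μ ν x = Π⁰_{μν}(x)` is the polarized six loops of `polarization_eq_sixLoops` at `i = ((x,μ),a₀)`, `j = ((0,ν),a₀)`. -/
theorem torusKernel_eq_sixLoops (F : Family (ExtIndex d s c) n m)
    (hQ : ∀ a b, ContDiffAt ℝ 2 (fun B => (F B).Q a b) 0) (hΔ : ∀ a b, ContDiffAt ℝ 2 (fun B => (F B).Δ a b) 0)
    (hdet : (F 0).kkt.det ≠ 0) (hsymm : ∀ᶠ B in 𝓝 (0 : ExtIndex d s c → ℝ), (F B).Δ.IsSymm)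
    (a₀ : Fin c) (μ ν : Fin d) (x : Site d s) :
    torusKernel F a₀ μ ν x =
      -(1 / 2 : ℝ) * (flucCov (F 0).Δ (F 0).Q * F.d2Δ ((x, μ), a₀) ((0, ν), a₀)).trace
        + (1 / 2 : ℝ) * (flucCov (F 0).Δ (F 0).Q * F.dΔ ((x, μ), a₀) * flucCov (F 0).Δ (F 0).Q * F.dΔ ((0, ν), a₀)).trace
        - (minOp (F 0).Δ (F 0).Q * F.d2Q ((x, μ), a₀) ((0, ν), a₀)).trace
        + (minOp (F 0).Δ (F 0).Q * F.dQ ((x, μ), a₀) * minOp (F 0).Δ (F 0).Q * F.dQ ((0, ν), a₀)).trace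
        - (flucCov (F 0).Δ (F 0).Q * (F.dQ ((x, μ), a₀))ᵀ * effForm (F 0).Δ (F 0).Q * F.dQ ((0, ν), a₀)).trace
        + (flucCov (F 0).Δ (F 0).Q * F.dΔ ((x, μ), a₀) * minOp (F 0).Δ (F 0).Q * F.dQ ((0, ν), a₀)).trace
        + (flucCov (F 0).Δ (F 0).Q * F.dΔ ((0, ν), a₀) * minOp (F 0).Δ (F 0).Q * F.dQ ((x, μ), a₀)).trace := by
  unfold torusKernel
  exact polarization_eq_sixLoops F hQ hΔ hdet hsymm _ _

omit [NeZero s] in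
/-- [folklore] **… AND IT IS THE HESSIAN OF `W = −½·log|det 𝕂|` ALONE** (GAMMA-7 ✓ BY NAME, `ConstraintNormalisation`): for EVERY torus family,
`torusKernel F a₀ μ ν x = hessianAt (B ↦ −½·log|det kkt(F B)|) ((x,μ),a₀) ((0,ν),a₀)` — the row's `W_n` needs no normalisation term in the Lie-algebra δ. -/
theorem torusKernel_eq_hessianAt_W [NeZero s] (F : Family (ExtIndex d s c) n m) (a₀ : Fin c) (μ ν : Fin d) (x : Site d s) :
    torusKernel F a₀ μ ν x =
      hessianAt (fun B => -(1 / 2 : ℝ) * Real.log |(F B).kkt.det|) ((x, μ), a₀) (((0 : Site d s), ν), a₀) :=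
  ConstraintNormalisation.torusKernel_eq_hessianAt_negHalfLogAbsDetKKT F a₀ μ ν x

end Torus

/-! ## §3 Through the minimiser: transport on both legs, the ghost, and the tadpole·`U″` term -/

section Minimiser

variable {ι κ : Type*} [Fintype ι] [DecidableEq ι] [Fintype κ] [DecidableEq κ] {n m : ℕ}

/-- [folklore] **THE ONE SHOT THROUGH THE MINIMISER** (row GAMMA-0: «`H₁ = Ḣ_cov[𝓘v]` by the chain rule through the minimiser; … + the K_n-ghost
term»; the `U″` term displayed).  Let `F : Family κ n m` be the fine one-shot family (`C²` entries at `0`, nonsingular `K₀`, `Δ_B` symmetric near `0`),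
`U : (ι → ℝ) → (κ → ℝ)` the minimiser map on backgrounds (`U 0 = 0`, `C²` at `0`), `Gh` a `C²` scalar functional (the ghost term) and `Φ` the one-shot
functional, `Φ =ᶠ[𝓝 0] (V ↦ log Z(F (U V)) + Gh V + c)`.  Then, with `J_{ia} := ∂ᵢU_a(0)`, `U″_{a,ij} := ∂ᵢ∂ⱼU_a(0)` and `[six loops]_{ab}` the right
member of `polarization_eq_sixLoops`,
`hessianAt Φ i j = Σ_a Σ_b J_{ia}·J_{jb}·[six loops]_{ab} + hessianAt Gh i j + Σ_a U″_{a,ij}·(−½tr(Γ∂_aΔ) − tr(𝓘∂_aQ))`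
— the six loops TRANSPORTED ON BOTH LEGS by `J` (on the road `J = 𝓘_n`, RHOA-DESIGN §0 — not used), the ghost Hessian, and the TADPOLE VECTOR IN BLOCKS
(an2's K-U4 `fderiv_logZ_single_blocks_of_symm`) contracted with the minimiser's second response (an2's K-U2 `hessianAt_comp_eq`). -/
theorem hessianAt_oneShot_eq (F : Family κ n m) {Φ Gh : (ι → ℝ) → ℝ} {U : (ι → ℝ) → (κ → ℝ)} {c : ℝ}
    (hΦ : Φ =ᶠ[𝓝 0] fun V => F.logZ (U V) + Gh V + c) (hU0 : U 0 = 0) (hU : ContDiffAt ℝ 2 U 0) (hGh : ContDiffAt ℝ 2 Gh 0)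
    (hQ : ∀ a b, ContDiffAt ℝ 2 (fun B => (F B).Q a b) 0) (hΔ : ∀ a b, ContDiffAt ℝ 2 (fun B => (F B).Δ a b) 0)
    (hdet : (F 0).kkt.det ≠ 0) (hsymm : ∀ᶠ B in 𝓝 (0 : κ → ℝ), (F B).Δ.IsSymm) (i j : ι) :
    hessianAt Φ i j =
      (∑ a, ∑ b, (fderiv ℝ U 0 (Pi.single i 1) a * fderiv ℝ U 0 (Pi.single j 1) b) *
          (-(1 / 2 : ℝ) * (flucCov (F 0).Δ (F 0).Q * F.d2Δ a b).trace
            + (1 / 2 : ℝ) * (flucCov (F 0).Δ (F 0).Q * F.dΔ a * flucCov (F 0).Δ (F 0).Q * F.dΔ b).trace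
            - (minOp (F 0).Δ (F 0).Q * F.d2Q a b).trace
            + (minOp (F 0).Δ (F 0).Q * F.dQ a * minOp (F 0).Δ (F 0).Q * F.dQ b).trace
            - (flucCov (F 0).Δ (F 0).Q * (F.dQ a)ᵀ * effForm (F 0).Δ (F 0).Q * F.dQ b).trace
            + (flucCov (F 0).Δ (F 0).Q * F.dΔ a * minOp (F 0).Δ (F 0).Q * F.dQ b).trace
            + (flucCov (F 0).Δ (F 0).Q * F.dΔ b * minOp (F 0).Δ (F 0).Q * F.dQ a).trace))
        + hessianAt Gh i j
        + ∑ a, fderiv ℝ (fderiv ℝ U) 0 (Pi.single i 1) (Pi.single j 1) a *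
            (-(1 / 2 : ℝ) * (flucCov (F 0).Δ (F 0).Q * F.dΔ a).trace - (minOp (F 0).Δ (F 0).Q * F.dQ a).trace) := by
  have hQ1 : ∀ a b, ContDiffAt ℝ 1 (fun B => (F B).Q a b) 0 := fun a b => (hQ a b).of_le (by norm_num)
  have hΔ1 : ∀ a b, ContDiffAt ℝ 1 (fun B => (F B).Δ a b) 0 := fun a b => (hΔ a b).of_le (by norm_num)
  rw [hessianAt_comp_eq hΦ hU0 hU (F.contDiffAt_logZ hQ hΔ hdet) hGh i j]
  congr 1
  · congr 1
    refine Finset.sum_congr rfl fun a _ => Finset.sum_congr rfl fun b _ => ?_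
    rw [← polarization_eq_hessianAt, polarization_eq_sixLoops F hQ hΔ hdet hsymm a b]
  · refine Finset.sum_congr rfl fun a _ => ?_
    rw [fderiv_logZ_single_blocks_of_symm F hQ1 hΔ1 hdet hsymm.self_of_nhds a]

/-- [folklore] **TADPOLE-FREE ⟹ THE MINIMISER'S SECOND RESPONSE NEVER ENTERS** (row GAMMA-0: «S4 kills the `U_n″` term», functional form): if, in
addition, every single-insertion contraction vanishes at the base point, `−½tr(Γ∂_aΔ) − tr(𝓘∂_aQ) = 0` for all `a` (an2's K-U4: ⟺ `fderiv ℝ F.logZ 0 = 0`;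
from a parity by `LogZFirstJet.fderiv_logZ_eq_zero_of_parity` ∕ `…_of_twisted_parity`), then
`hessianAt Φ i j = Σ_a Σ_b J_{ia}·J_{jb}·[six loops]_{ab} + hessianAt Gh i j`. -/
theorem hessianAt_oneShot_eq_of_tadpoleFree (F : Family κ n m) {Φ Gh : (ι → ℝ) → ℝ} {U : (ι → ℝ) → (κ → ℝ)} {c : ℝ}
    (hΦ : Φ =ᶠ[𝓝 0] fun V => F.logZ (U V) + Gh V + c) (hU0 : U 0 = 0) (hU : ContDiffAt ℝ 2 U 0) (hGh : ContDiffAt ℝ 2 Gh 0)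
    (hQ : ∀ a b, ContDiffAt ℝ 2 (fun B => (F B).Q a b) 0) (hΔ : ∀ a b, ContDiffAt ℝ 2 (fun B => (F B).Δ a b) 0)
    (hdet : (F 0).kkt.det ≠ 0) (hsymm : ∀ᶠ B in 𝓝 (0 : κ → ℝ), (F B).Δ.IsSymm)
    (htad : ∀ a, -(1 / 2 : ℝ) * (flucCov (F 0).Δ (F 0).Q * F.dΔ a).trace - (minOp (F 0).Δ (F 0).Q * F.dQ a).trace = 0)
    (i j : ι) :
    hessianAt Φ i j =
      (∑ a, ∑ b, (fderiv ℝ U 0 (Pi.single i 1) a * fderiv ℝ U 0 (Pi.single j 1) b) *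
          (-(1 / 2 : ℝ) * (flucCov (F 0).Δ (F 0).Q * F.d2Δ a b).trace
            + (1 / 2 : ℝ) * (flucCov (F 0).Δ (F 0).Q * F.dΔ a * flucCov (F 0).Δ (F 0).Q * F.dΔ b).trace
            - (minOp (F 0).Δ (F 0).Q * F.d2Q a b).trace
            + (minOp (F 0).Δ (F 0).Q * F.dQ a * minOp (F 0).Δ (F 0).Q * F.dQ b).trace
            - (flucCov (F 0).Δ (F 0).Q * (F.dQ a)ᵀ * effForm (F 0).Δ (F 0).Q * F.dQ b).trace
            + (flucCov (F 0).Δ (F 0).Q * F.dΔ a * minOp (F 0).Δ (F 0).Q * F.dQ b).trace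
            + (flucCov (F 0).Δ (F 0).Q * F.dΔ b * minOp (F 0).Δ (F 0).Q * F.dQ a).trace))
        + hessianAt Gh i j := by
  rw [hessianAt_oneShot_eq F hΦ hU0 hU hGh hQ hΔ hdet hsymm i j]
  simp only [htad, mul_zero, Finset.sum_const_zero, add_zero]

end Minimiser

/-! ## §4 The transported jets in closed form: `Ḣᵢ = Σ_a J_{ia}∂_aΔ`, `Ḧᵢⱼ = Σ_{ab} J_{ia}J_{jb}∂_a∂_bΔ`, … -/

section Transport

variable {κ α β γ δ : Type*} [Fintype κ] [Fintype α] [Fintype β] [Fintype γ] [Fintype δ]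

/-- [folklore] Bilinearity, second-jet shape: `Σ_a Σ_b x_a y_b·tr(A·M_{ab}) = tr(A·Σ_{ab} x_a y_b M_{ab})`. -/
theorem sum_sum_mul_trace_mul₂ (A : Matrix α β ℝ) (M : κ → κ → Matrix β α ℝ) (x y : κ → ℝ) :
    ∑ a, ∑ b, x a * y b * (A * M a b).trace = (A * ∑ a, ∑ b, (x a * y b) • M a b).trace := by
  simp only [Matrix.mul_sum, Matrix.mul_smul, Matrix.trace_sum, Matrix.trace_smul, smul_eq_mul]

/-- [folklore] Bilinearity, bubble shape: `Σ_a Σ_b x_a y_b·tr(A·P_a·B·R_b) = tr(A·(Σ_a x_aP_a)·B·(Σ_b y_bR_b))`. -/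
theorem sum_sum_mul_trace_mul₄ (A : Matrix α β ℝ) (P : κ → Matrix β γ ℝ) (B : Matrix γ δ ℝ) (R : κ → Matrix δ α ℝ)
    (x y : κ → ℝ) :
    ∑ a, ∑ b, x a * y b * (A * P a * B * R b).trace = (A * (∑ a, x a • P a) * B * (∑ b, y b • R b)).trace := by
  simp only [Matrix.mul_sum, Matrix.sum_mul, Matrix.mul_smul, Matrix.smul_mul, Matrix.trace_sum, Matrix.trace_smul,
    smul_eq_mul]
  rw [Finset.sum_comm]
  refine Finset.sum_congr rfl fun b _ => ?_
  rw [Finset.mul_sum]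
  refine Finset.sum_congr rfl fun a _ => ?_
  ring

/-- [folklore] Bilinearity, bubble shape with the weights swapped: `Σ_a Σ_b x_a y_b·tr(A·P_b·B·R_a) = tr(A·(Σ_b y_bP_b)·B·(Σ_a x_aR_a))`. -/
theorem sum_sum_mul_trace_mul₄' (A : Matrix α β ℝ) (P : κ → Matrix β γ ℝ) (B : Matrix γ δ ℝ) (R : κ → Matrix δ α ℝ)
    (x y : κ → ℝ) :
    ∑ a, ∑ b, x a * y b * (A * P b * B * R a).trace = (A * (∑ b, y b • P b) * B * (∑ a, x a • R a)).trace := by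
  rw [← sum_sum_mul_trace_mul₄ A P B R y x, Finset.sum_comm]
  refine Finset.sum_congr rfl fun a _ => Finset.sum_congr rfl fun b _ => ?_
  ring

omit [Fintype α] [Fintype β] in
/-- [folklore] Transposition commutes with a weighted sum of matrices. -/
theorem transpose_sum_smul (P : κ → Matrix α β ℝ) (x : κ → ℝ) : (∑ a, x a • P a)ᵀ = ∑ a, x a • (P a)ᵀ := by
  rw [Matrix.transpose_sum]
  simp only [Matrix.transpose_smul]

variable {ν μ : Type*} [Fintype ν] [Fintype μ]

/-- [folklore] **TRANSPORT OF THE POLARIZED SIX LOOPS ON BOTH LEGS** (pure bilinear algebra; any legs `Γ, 𝓘, 𝔊`, any jets, any weights `x, y`): contracting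
the `(a,b)`-indexed six loops with `x_a·y_b` IS the six loops of the TRANSPORTED JETS `Ḣ[x] := Σ_a x_a H₁(a)`, `Q̇[x] := Σ_a x_a Q₁(a)`,
`Ḧ[x,y] := Σ_{ab} x_a y_b H₂(a,b)`, `Q̈[x,y] := Σ_{ab} x_a y_b Q₂(a,b)` — «the six loops as a bilinear form in `v`». -/
theorem sixLoops_transport (Γ : Matrix ν ν ℝ) (𝓘 : Matrix ν μ ℝ) (𝔊 : Matrix μ μ ℝ)
    (H₁ : κ → Matrix ν ν ℝ) (Q₁ : κ → Matrix μ ν ℝ) (H₂ : κ → κ → Matrix ν ν ℝ) (Q₂ : κ → κ → Matrix μ ν ℝ) (x y : κ → ℝ) :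
    ∑ a, ∑ b, x a * y b *
        (-(1 / 2 : ℝ) * (Γ * H₂ a b).trace + (1 / 2 : ℝ) * (Γ * H₁ a * Γ * H₁ b).trace - (𝓘 * Q₂ a b).trace
          + (𝓘 * Q₁ a * 𝓘 * Q₁ b).trace - (Γ * (Q₁ a)ᵀ * 𝔊 * Q₁ b).trace + (Γ * H₁ a * 𝓘 * Q₁ b).trace
          + (Γ * H₁ b * 𝓘 * Q₁ a).trace)
      = -(1 / 2 : ℝ) * (Γ * ∑ a, ∑ b, (x a * y b) • H₂ a b).trace
          + (1 / 2 : ℝ) * (Γ * (∑ a, x a • H₁ a) * Γ * (∑ b, y b • H₁ b)).trace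
          - (𝓘 * ∑ a, ∑ b, (x a * y b) • Q₂ a b).trace
          + (𝓘 * (∑ a, x a • Q₁ a) * 𝓘 * (∑ b, y b • Q₁ b)).trace
          - (Γ * (∑ a, x a • Q₁ a)ᵀ * 𝔊 * (∑ b, y b • Q₁ b)).trace
          + (Γ * (∑ a, x a • H₁ a) * 𝓘 * (∑ b, y b • Q₁ b)).trace
          + (Γ * (∑ b, y b • H₁ b) * 𝓘 * (∑ a, x a • Q₁ a)).trace := by
  rw [transpose_sum_smul, ← sum_sum_mul_trace_mul₂ Γ H₂, ← sum_sum_mul_trace_mul₂ 𝓘 Q₂, ← sum_sum_mul_trace_mul₄ Γ H₁ Γ H₁,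
    ← sum_sum_mul_trace_mul₄ 𝓘 Q₁ 𝓘 Q₁, ← sum_sum_mul_trace_mul₄ Γ (fun a => (Q₁ a)ᵀ) 𝔊 Q₁,
    ← sum_sum_mul_trace_mul₄ Γ H₁ 𝓘 Q₁, ← sum_sum_mul_trace_mul₄' Γ H₁ 𝓘 Q₁]
  simp only [Finset.mul_sum, ← Finset.sum_add_distrib, ← Finset.sum_sub_distrib]
  refine Finset.sum_congr rfl fun a _ => Finset.sum_congr rfl fun b _ => ?_
  ring

end Transport

section TransportedOneShot

variable {ι κ : Type*} [Fintype ι] [DecidableEq ι] [Fintype κ] [DecidableEq κ] {n m : ℕ}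

/-- [folklore] **THE ONE SHOT THROUGH THE MINIMISER, TRANSPORTED JETS IN CLOSED FORM** (row GAMMA-0: «the six loops … with `H₁ = Ḣ_cov[Jv]`, `Q₁ = Q̇[Jv]`,
`H₂, Q₂` the second jets»): under the hypotheses of `hessianAt_oneShot_eq`, writing `Jᵢ := ∂ᵢU(0) : κ → ℝ`, `Ḣᵢ := Σ_a Jᵢ_a·∂_aΔ`, `Q̇ᵢ := Σ_a Jᵢ_a·∂_aQ`,
`Ḧᵢⱼ := Σ_{ab} Jᵢ_aJⱼ_b·∂_a∂_bΔ`, `Q̈ᵢⱼ := Σ_{ab} Jᵢ_aJⱼ_b·∂_a∂_bQ` (the jets of `Δ ∘ U`, `Q ∘ U` MINUS their `U″` parts),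
`hessianAt Φ i j = −½tr(ΓḦᵢⱼ) + ½tr(ΓḢᵢΓḢⱼ) − tr(𝓘Q̈ᵢⱼ) + tr(𝓘Q̇ᵢ𝓘Q̇ⱼ) − tr(ΓQ̇ᵢᵀ𝔊Q̇ⱼ) + tr(ΓḢᵢ𝓘Q̇ⱼ) + tr(ΓḢⱼ𝓘Q̇ᵢ) + hessianAt Gh i j`
`  + Σ_a U″_{a,ij}·(−½tr(Γ∂_aΔ) − tr(𝓘∂_aQ))`. -/
theorem hessianAt_oneShot_eq_transported (F : Family κ n m) {Φ Gh : (ι → ℝ) → ℝ} {U : (ι → ℝ) → (κ → ℝ)} {c : ℝ}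
    (hΦ : Φ =ᶠ[𝓝 0] fun V => F.logZ (U V) + Gh V + c) (hU0 : U 0 = 0) (hU : ContDiffAt ℝ 2 U 0) (hGh : ContDiffAt ℝ 2 Gh 0)
    (hQ : ∀ a b, ContDiffAt ℝ 2 (fun B => (F B).Q a b) 0) (hΔ : ∀ a b, ContDiffAt ℝ 2 (fun B => (F B).Δ a b) 0)
    (hdet : (F 0).kkt.det ≠ 0) (hsymm : ∀ᶠ B in 𝓝 (0 : κ → ℝ), (F B).Δ.IsSymm) (i j : ι) :
    hessianAt Φ i j =
      (-(1 / 2 : ℝ) * (flucCov (F 0).Δ (F 0).Q *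
            ∑ a, ∑ b, (fderiv ℝ U 0 (Pi.single i 1) a * fderiv ℝ U 0 (Pi.single j 1) b) • F.d2Δ a b).trace
        + (1 / 2 : ℝ) * (flucCov (F 0).Δ (F 0).Q * (∑ a, fderiv ℝ U 0 (Pi.single i 1) a • F.dΔ a)
            * flucCov (F 0).Δ (F 0).Q * (∑ b, fderiv ℝ U 0 (Pi.single j 1) b • F.dΔ b)).trace
        - (minOp (F 0).Δ (F 0).Q *
            ∑ a, ∑ b, (fderiv ℝ U 0 (Pi.single i 1) a * fderiv ℝ U 0 (Pi.single j 1) b) • F.d2Q a b).trace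
        + (minOp (F 0).Δ (F 0).Q * (∑ a, fderiv ℝ U 0 (Pi.single i 1) a • F.dQ a)
            * minOp (F 0).Δ (F 0).Q * (∑ b, fderiv ℝ U 0 (Pi.single j 1) b • F.dQ b)).trace
        - (flucCov (F 0).Δ (F 0).Q * (∑ a, fderiv ℝ U 0 (Pi.single i 1) a • F.dQ a)ᵀ
            * effForm (F 0).Δ (F 0).Q * (∑ b, fderiv ℝ U 0 (Pi.single j 1) b • F.dQ b)).trace
        + (flucCov (F 0).Δ (F 0).Q * (∑ a, fderiv ℝ U 0 (Pi.single i 1) a • F.dΔ a)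
            * minOp (F 0).Δ (F 0).Q * (∑ b, fderiv ℝ U 0 (Pi.single j 1) b • F.dQ b)).trace
        + (flucCov (F 0).Δ (F 0).Q * (∑ b, fderiv ℝ U 0 (Pi.single j 1) b • F.dΔ b)
            * minOp (F 0).Δ (F 0).Q * (∑ a, fderiv ℝ U 0 (Pi.single i 1) a • F.dQ a)).trace)
        + hessianAt Gh i j
        + ∑ a, fderiv ℝ (fderiv ℝ U) 0 (Pi.single i 1) (Pi.single j 1) a *
            (-(1 / 2 : ℝ) * (flucCov (F 0).Δ (F 0).Q * F.dΔ a).trace - (minOp (F 0).Δ (F 0).Q * F.dQ a).trace) := by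
  rw [hessianAt_oneShot_eq F hΦ hU0 hU hGh hQ hΔ hdet hsymm i j, sixLoops_transport]

/-- [folklore] A weighted sum of the (symmetric) first variations of a family of symmetric forms is symmetric. -/
theorem transpose_sum_smul_dΔ (F : Family κ n m) (hsymm : ∀ᶠ B in 𝓝 (0 : κ → ℝ), (F B).Δ.IsSymm) (x : κ → ℝ) :
    (∑ a, x a • F.dΔ a)ᵀ = ∑ a, x a • F.dΔ a := by
  rw [transpose_sum_smul]
  exact Finset.sum_congr rfl fun a _ => by rw [(F.dΔ_isSymm hsymm a).eq]

/-- [folklore] **ON THE DIAGONAL, TADPOLE-FREE: `W_n″(0)` ALONG `V = t·eᵢ` IS RHOA-10's `sixLoops_kkt` WITH THE TRANSPORTED JETS, PLUS THE GHOST** (row GAMMA-0's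
sentence in the `hessianAt` currency): under the hypotheses of `hessianAt_oneShot_eq` and the S4-type hypothesis `∀ a, −½tr(Γ∂_aΔ) − tr(𝓘∂_aQ) = 0`, with
`Ḣᵢ, Q̇ᵢ, Ḧᵢᵢ, Q̈ᵢᵢ` as in `hessianAt_oneShot_eq_transported`,
`hessianAt Φ i i = −½·secondVar (kkt Δ₀ Q₀) (kkt Ḣᵢ Q̇ᵢ) (kkt Ḧᵢᵢ Q̈ᵢᵢ) + hessianAt Gh i i`
(`−½·secondVar … = ½tr(ΓḢΓḢ) − ½tr(ΓḦ) + 2tr(ΓḢ𝓘Q̇) + tr(𝓘Q̇𝓘Q̇) − tr(𝔊·Q̇ΓQ̇ᵀ) − tr(𝓘Q̈)` by `KKTSecondVariation.sixLoops_kkt`). -/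
theorem hessianAt_oneShot_diag_eq_sixLoops_kkt_of_tadpoleFree (F : Family κ n m) {Φ Gh : (ι → ℝ) → ℝ} {U : (ι → ℝ) → (κ → ℝ)} {c : ℝ}
    (hΦ : Φ =ᶠ[𝓝 0] fun V => F.logZ (U V) + Gh V + c) (hU0 : U 0 = 0) (hU : ContDiffAt ℝ 2 U 0) (hGh : ContDiffAt ℝ 2 Gh 0)
    (hQ : ∀ a b, ContDiffAt ℝ 2 (fun B => (F B).Q a b) 0) (hΔ : ∀ a b, ContDiffAt ℝ 2 (fun B => (F B).Δ a b) 0)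
    (hdet : (F 0).kkt.det ≠ 0) (hsymm : ∀ᶠ B in 𝓝 (0 : κ → ℝ), (F B).Δ.IsSymm)
    (htad : ∀ a, -(1 / 2 : ℝ) * (flucCov (F 0).Δ (F 0).Q * F.dΔ a).trace - (minOp (F 0).Δ (F 0).Q * F.dQ a).trace = 0)
    (i : ι) :
    hessianAt Φ i i =
      -(1 / 2 : ℝ) * secondVar (kkt (F 0).Δ (F 0).Q)
          (kkt (∑ a, fderiv ℝ U 0 (Pi.single i 1) a • F.dΔ a) (∑ a, fderiv ℝ U 0 (Pi.single i 1) a • F.dQ a))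
          (kkt (∑ a, ∑ b, (fderiv ℝ U 0 (Pi.single i 1) a * fderiv ℝ U 0 (Pi.single i 1) b) • F.d2Δ a b)
            (∑ a, ∑ b, (fderiv ℝ U 0 (Pi.single i 1) a * fderiv ℝ U 0 (Pi.single i 1) b) • F.d2Q a b))
        + hessianAt Gh i i := by
  rw [hessianAt_oneShot_eq_transported F hΦ hU0 hU hGh hQ hΔ hdet hsymm i i,
    sixLoops_kkt _ _ _ _ _ _ hsymm.self_of_nhds.eq (transpose_sum_smul_dΔ F hsymm _)]
  simp only [htad, mul_zero, Finset.sum_const_zero, add_zero]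
  -- the `𝔊`-term by cyclicity, the rest by reassociation
  rw [Matrix.mul_assoc (flucCov (F 0).Δ (F 0).Q * (∑ a, fderiv ℝ U 0 (Pi.single i 1) a • F.dQ a)ᵀ),
    Matrix.trace_mul_comm (flucCov (F 0).Δ (F 0).Q * (∑ a, fderiv ℝ U 0 (Pi.single i 1) a • F.dQ a)ᵀ)]
  simp only [Matrix.mul_assoc]
  ring

end TransportedOneShot

end Summit.QuantumFields.BalabanUV.Beta.FP.OneShotKKTPolarization

end
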